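import Literature.NumberTheory.Transcendental.CurvePeriodsEllipticSegmentsProofs
import Literature.NumberTheory.Transcendental.CurvePeriodsHomotopyProofs
import Mathlib.Analysis.SpecialFunctions.SmoothTransition
import HarnessLib

/-!
# Periods of curve type on an elliptic curve, IV: splitting, lifted paths and smooth polygons

Companion of `CurvePeriodsEllipticSegmentsProofs.lean` (segment symbols on the Weierstrass curve
`E_L` of a period pair `L`, uniformised by `φ = (℘, ℘′/2)`) and of `CurvePeriodsHomotopyProofs.lean`
(homotopic paths have the same symbol). Tools for replacing a lifted path `φ ∘ γ̃` by a sum of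
segment symbols (Huber–Wüstholz 2022, §3.3.1: "Up to homotopy such a cycle can be replaced by a
formal `ℤ`-linear combination of … paths with endpoints in `Y(k)`"; here on `E_L`, through the
uniformisation of §18.1):

* `isElementaryRelation_split` — **splitting a path at an algebraic interior point is (R5)**:
  for a `C¹` path `P` on any curve and `τ ∈ [0,1]` with `P(τ)` algebraic,
  `P(τ·) + P(τ + (1−τ)·) − P ∼ 0`, the boundary of the `C¹` triangle `(a, b) ↦ P(τa + b)`;
* `Ell.liftPath` — the symbol path `φ ∘ g` of a `C¹` map `g : ℝ → ℂ` avoiding `Λ` on `[0,1]` with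
  algebraic end points; `Ell.span_liftPath_sub_liftPath_of_convex` — two such maps with the same
  end points whose straight-line homotopy avoids `Λ` give the same symbol (mod relations);
* `Ell.span_liftPath_slots` — `φ ∘ g ∼ Σ_{i<N} φ ∘ g((i + ·)/N)` when the points `g(i/N)` are
  algebraic (iterated splitting);
* `Ell.polygon`, `Ell.polygon_slot` — the **smooth polygon** through vertices `w₀, …, w_N`
  (`C¹`, built from Mathlib's `Real.smoothTransition`; on the `i`-th time slot it is the smooth
  segment `wᵢ + s(t)(wᵢ₊₁ − wᵢ)`), and `Ell.span_smoothSeg_sub_segPath` — a smooth segment has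
  the symbol of the straight segment `φ∘[a, b]` (`segPath`).

## References

* A. Huber, G. Wüstholz, *Transcendence and Linear Relations of 1-Periods*, Cambridge Tracts in
  Mathematics 227, CUP 2022 [HuberWustholz2022]: §3.3.1 (pp. 42–44), §18.1 (p. 160), Thm. 13.3 (2).
-/

noncomputable section

open scoped BigOperators
open scoped PeriodPair
open MvPolynomial Set Complex

namespace Literature.NumberTheory.Transcendental

namespace CurvePeriods

set_option quotPrecheck false in
/-- Membership in the `ℚ̄`-span of the elementary relations, in the format of the conclusion of
`HuberWustholzCurvePeriods`. -/
local notation "InSpan" c:max => ∃ (k : ℕ) (ρ : Fin k → (PeriodSymbol →₀ ℂ)) (a : Fin k → ℂ),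
  (∀ l, IsElementaryRelation (ρ l)) ∧ (∀ l, IsAlgebraic ℚ (a l)) ∧ c = ∑ l, a l • ρ l

/-! ### Splitting a path at an algebraic point -/

variable {Z : CurveData}

/-- **Affine reparametrisation** `t ↦ P(a + bt)` of a `C¹` path along an affine map of `[0,1]`
into `[0,1]`, with algebraic end points `P(a)`, `P(a + b)`. [folklore] -/
def CurvePath.affineReparam (P : CurvePath Z) (a b : ℝ)
    (hmap : ∀ t ∈ Icc (0 : ℝ) 1, a + b * t ∈ Icc (0 : ℝ) 1)
    (h0 : ∀ i, IsAlgebraic ℚ (P.toFun a i)) (h1 : ∀ i, IsAlgebraic ℚ (P.toFun (a + b) i)) :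
    CurvePath Z where
  toFun t := P.toFun (a + b * t)
  contDiffOn := P.contDiffOn.comp (contDiff_const.add (contDiff_const.mul contDiff_id)).contDiffOn hmap
  mem_points t ht := P.mem_points _ (hmap t ht)
  algebraic_zero i := by simpa using h0 i
  algebraic_one i := by simpa using h1 i

/-- The parametrisation of `affineReparam`. [folklore] -/
@[simp] theorem CurvePath.affineReparam_toFun (P : CurvePath Z) (a b : ℝ)
    (hmap : ∀ t ∈ Icc (0 : ℝ) 1, a + b * t ∈ Icc (0 : ℝ) 1)
    (h0 : ∀ i, IsAlgebraic ℚ (P.toFun a i)) (h1 : ∀ i, IsAlgebraic ℚ (P.toFun (a + b) i)) (t : ℝ) :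
    (P.affineReparam a b hmap h0 h1).toFun t = P.toFun (a + b * t) := rfl

/-- **Splitting is (R5).** For a `C¹` path `P` on `Z`, `τ ∈ [0,1]`, and paths `P₁`, `P₂` agreeing
on `[0,1]` with `t ↦ P(τt)` and `t ↦ P(τ + (1 − τ)t)` (so `P(τ)` is algebraic),
`(Z, ω, P₁) + (Z, ω, P₂) − (Z, ω, P)` is the boundary relation of the `C¹` triangle
`(a, b) ↦ P(τa + b)` (edges `P(τt)`, `P(τ(1 − t) + t)`, `P(t)`). In the book's terms: a `1`-simplex
is homologous to the sum of the two halves of a subdivision. [cite: HuberWustholz2022, §3.3.1 (p. 42)] -/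
theorem isElementaryRelation_split (hZ : Z.IsSmoothAffineCurve)
    (ω : Fin Z.n → MvPolynomial (Fin Z.n) ℂ) (hω : ∀ i, HasAlgCoeffs (ω i)) (P P₁ P₂ : CurvePath Z)
    {τ : ℝ} (hτ : τ ∈ Icc (0 : ℝ) 1)
    (h₁ : ∀ t ∈ Icc (0 : ℝ) 1, P₁.toFun t = P.toFun (τ * t))
    (h₂ : ∀ t ∈ Icc (0 : ℝ) 1, P₂.toFun t = P.toFun (τ + (1 - τ) * t)) :
    IsElementaryRelation
      (Finsupp.single (⟨Z, hZ, ω, hω, P₁⟩ : PeriodSymbol) 1 +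
        Finsupp.single (⟨Z, hZ, ω, hω, P₂⟩ : PeriodSymbol) 1 -
        Finsupp.single (⟨Z, hZ, ω, hω, P⟩ : PeriodSymbol) 1) := by
  have hmap : ∀ q ∈ stdTriangle, τ * q.1 + q.2 ∈ Icc (0 : ℝ) 1 := fun q hq =>
    ⟨by nlinarith [hq.1, hq.2.1, hτ.1], by nlinarith [hq.1, hq.2.1, hq.2.2, hτ.2]⟩
  have hT : ContDiffOn ℝ 1 (fun q : ℝ × ℝ => P.toFun (τ * q.1 + q.2)) stdTriangle :=
    P.contDiffOn.comp ((contDiff_const.mul contDiff_fst).add contDiff_snd).contDiffOn hmap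
  refine IsElementaryRelation.boundary Z hZ ω hω _ hT (fun q hq => P.mem_points _ (hmap q hq))
    P₁ P₂ P (fun t ht => ?_) (fun t ht => ?_) (fun t _ => ?_)
  · rw [h₁ t ht]
    simp
  · rw [h₂ t ht]
    simp only
    congr 1
    ring
  · simp

namespace Ell

variable (L : PeriodPair)

/-! ### Lifted paths `φ ∘ g` -/

/-- **The symbol path `φ ∘ g`** of a `C¹` map `g : ℝ → ℂ` avoiding `Λ` on `[0,1]` whose end
points `g(0)`, `g(1)` are algebraic points. [cite: HuberWustholz2022, §18.1 (p. 160)] -/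
def liftPath (g : ℝ → ℂ) (hg : ContDiff ℝ 1 g) (hΛ : ∀ t ∈ Icc (0 : ℝ) 1, g t ∉ L.lattice)
    (h0 : IsAlgPt L (g 0)) (h1 : IsAlgPt L (g 1)) : CurvePath (curve L) where
  toFun t := phi L (g t)
  contDiffOn := contDiffOn_pi.2 fun k =>
    (contDiffOn_phi L k).comp hg.contDiffOn fun t ht => hΛ t ht
  mem_points t ht := phi_mem_points L (hΛ t ht)
  algebraic_zero k := h0.2 k
  algebraic_one k := h1.2 k

/-- The parametrisation of `liftPath`. [folklore] -/
@[simp] theorem liftPath_toFun (g : ℝ → ℂ) (hg : ContDiff ℝ 1 g)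
    (hΛ : ∀ t ∈ Icc (0 : ℝ) 1, g t ∉ L.lattice) (h0 : IsAlgPt L (g 0)) (h1 : IsAlgPt L (g 1))
    (t : ℝ) : (liftPath L g hg hΛ h0 h1).toFun t = phi L (g t) := rfl

/-- Two lifted paths with the same function are equal (proof irrelevance). [folklore] -/
theorem liftPath_congr {g g' : ℝ → ℂ} (hgg' : ∀ t, g t = g' t) (hg : ContDiff ℝ 1 g)
    (hΛ : ∀ t ∈ Icc (0 : ℝ) 1, g t ∉ L.lattice) (h0 : IsAlgPt L (g 0)) (h1 : IsAlgPt L (g 1))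
    (hg' : ContDiff ℝ 1 g') (hΛ' : ∀ t ∈ Icc (0 : ℝ) 1, g' t ∉ L.lattice) (h0' : IsAlgPt L (g' 0))
    (h1' : IsAlgPt L (g' 1)) : liftPath L g hg hΛ h0 h1 = liftPath L g' hg' hΛ' h0' h1' :=
  CurvePath.eq_of_toFun_eq fun t => by simp [hgg' t]

/-- **Straight-line homotopic lifts have the same symbol.** If `g₀, g₁ : ℝ → ℂ` are `C¹` with
the same end points and the segments `[g₀(t), g₁(t)]`, `t ∈ [0,1]`, avoid `Λ`, then
`(E_L, ω, φ∘g₀) − (E_L, ω, φ∘g₁)` lies in the span of the elementary relations (push the homotopy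
`(1 − s)g₀ + s g₁` down by `φ`; `span_single_sub_single_of_homotopy`).
[cite: HuberWustholz2022, §3.3.1 (pp. 42–43)] -/
theorem span_liftPath_sub_liftPath_of_convex (hE : (curve L).IsSmoothAffineCurve)
    (ω : Fin 2 → MvPolynomial (Fin 2) ℂ) (hω : ∀ k, HasAlgCoeffs (ω k)) {g₀ g₁ : ℝ → ℂ}
    (hg₀ : ContDiff ℝ 1 g₀) (hg₁ : ContDiff ℝ 1 g₁)
    (hΛ₀ : ∀ t ∈ Icc (0 : ℝ) 1, g₀ t ∉ L.lattice) (hΛ₁ : ∀ t ∈ Icc (0 : ℝ) 1, g₁ t ∉ L.lattice)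
    (ha₀ : IsAlgPt L (g₀ 0)) (hb₀ : IsAlgPt L (g₀ 1)) (ha₁ : IsAlgPt L (g₁ 0)) (hb₁ : IsAlgPt L (g₁ 1))
    (hstart : g₁ 0 = g₀ 0) (hend : g₁ 1 = g₀ 1)
    (hconv : ∀ s ∈ Icc (0 : ℝ) 1, ∀ t ∈ Icc (0 : ℝ) 1,
      (1 - (s : ℂ)) * g₀ t + (s : ℂ) * g₁ t ∉ L.lattice) :
    InSpan (Finsupp.single (⟨curve L, hE, ω, hω, liftPath L g₀ hg₀ hΛ₀ ha₀ hb₀⟩ : PeriodSymbol) (1 : ℂ) -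
      Finsupp.single (⟨curve L, hE, ω, hω, liftPath L g₁ hg₁ hΛ₁ ha₁ hb₁⟩ : PeriodSymbol) 1) := by
  have hin : ContDiff ℝ 1 fun q : ℝ × ℝ => (1 - (q.1 : ℂ)) * g₀ q.2 + (q.1 : ℂ) * g₁ q.2 :=
    ((contDiff_const.sub (ofRealCLM.contDiff.comp contDiff_fst)).mul (hg₀.comp contDiff_snd)).add
      ((ofRealCLM.contDiff.comp contDiff_fst).mul (hg₁.comp contDiff_snd))
  refine span_single_sub_single_of_homotopy hE ω hω
    (fun q : ℝ × ℝ => phi L ((1 - (q.1 : ℂ)) * g₀ q.2 + (q.1 : ℂ) * g₁ q.2)) ?_ ?_ ?_ ?_ _ _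
    (fun t _ => by simp) (fun t _ => by simp)
  · exact contDiffOn_pi.2 fun k =>
      (contDiffOn_phi L k).comp hin.contDiffOn fun q hq => hconv q.1 hq.1 q.2 hq.2
  · exact fun q hq => phi_mem_points L (hconv q.1 hq.1 q.2 hq.2)
  · intro s _
    simp only [hstart, ofReal_zero, sub_zero, one_mul, zero_mul, add_zero]
    congr 1
    ring
  · intro s _
    simp only [hend, ofReal_zero, sub_zero, one_mul, zero_mul, add_zero]
    congr 1
    ring

/-! ### Slots -/

/-- The `i`-th of `m + 1` time slots: `t ↦ (i + t)/(m + 1)`. [folklore] -/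
def slot (m i : ℕ) (t : ℝ) : ℝ := (i + t) / (m + 1 : ℕ)

/-- `slot` is smooth. [folklore] -/
theorem contDiff_slot (m i : ℕ) : ContDiff ℝ 1 (slot m i) :=
  (contDiff_const.add contDiff_id).div_const _

/-- `slot m i t ≥ 0` for `t ≥ 0`. [folklore] -/
theorem slot_nonneg (m i : ℕ) {t : ℝ} (ht : 0 ≤ t) : 0 ≤ slot m i t := by
  unfold slot
  positivity

/-- `slot m i 0 = i/(m+1)`. [folklore] -/
theorem slot_zero (m i : ℕ) : slot m i 0 = (i : ℝ) / (m + 1 : ℕ) := by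
  simp [slot]

/-- `slot m i 1 = (i+1)/(m+1)`. [folklore] -/
theorem slot_one (m i : ℕ) : slot m i 1 = ((i + 1 : ℕ) : ℝ) / (m + 1 : ℕ) := by
  simp [slot]

variable {L} in
/-- **The lift of `g` restricted to the `i`-th slot**, for `g` `C¹`, avoiding `Λ` on `[0, ∞)` and
with `g(i/(m+1))` algebraic for all `i`. [folklore] -/
def slotLift {g : ℝ → ℂ} (hg : ContDiff ℝ 1 g) (hΛ : ∀ t : ℝ, 0 ≤ t → g t ∉ L.lattice) (m : ℕ)
    (halg : ∀ i : ℕ, IsAlgPt L (g (i / (m + 1 : ℕ)))) (i : ℕ) : CurvePath (curve L) :=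
  liftPath L (fun t => g (slot m i t)) (hg.comp (contDiff_slot m i))
    (fun t ht => hΛ _ (slot_nonneg m i ht.1)) (by rw [slot_zero]; exact halg i)
    (by rw [slot_one]; exact halg (i + 1))

variable {L} in
/-- **The lift of `g` on `[0,1]`**, for `g` as in `slotLift`. [folklore] -/
def wholeLift {g : ℝ → ℂ} (hg : ContDiff ℝ 1 g) (hΛ : ∀ t : ℝ, 0 ≤ t → g t ∉ L.lattice) (m : ℕ)
    (halg : ∀ i : ℕ, IsAlgPt L (g (i / (m + 1 : ℕ)))) : CurvePath (curve L) :=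
  liftPath L g hg (fun t ht => hΛ t ht.1) (by simpa using halg 0)
    (by
      have h := halg (m + 1)
      rwa [div_self (by exact_mod_cast Nat.succ_ne_zero m)] at h)

/-- [folklore] -/
@[simp] theorem slotLift_toFun {g : ℝ → ℂ} (hg : ContDiff ℝ 1 g)
    (hΛ : ∀ t : ℝ, 0 ≤ t → g t ∉ L.lattice) (m : ℕ) (halg : ∀ i : ℕ, IsAlgPt L (g (i / (m + 1 : ℕ))))
    (i : ℕ) (t : ℝ) : (slotLift hg hΛ m halg i).toFun t = phi L (g (slot m i t)) := rfl

/-- [folklore] -/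
@[simp] theorem wholeLift_toFun {g : ℝ → ℂ} (hg : ContDiff ℝ 1 g)
    (hΛ : ∀ t : ℝ, 0 ≤ t → g t ∉ L.lattice) (m : ℕ) (halg : ∀ i : ℕ, IsAlgPt L (g (i / (m + 1 : ℕ))))
    (t : ℝ) : (wholeLift hg hΛ m halg).toFun t = phi L (g t) := rfl

/-- **Slot decomposition**: `(E_L, ω, φ∘g) − Σ_{i ≤ m} (E_L, ω, φ∘g∘slotᵢ)` lies in the span of the
elementary relations (splitting `m` times at the algebraic points `g(i/(m+1))`).
[cite: HuberWustholz2022, §3.3.1 (p. 42)] -/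
theorem span_liftPath_slots (hE : (curve L).IsSmoothAffineCurve)
    (ω : Fin 2 → MvPolynomial (Fin 2) ℂ) (hω : ∀ k, HasAlgCoeffs (ω k)) (m : ℕ) :
    ∀ (g : ℝ → ℂ) (hg : ContDiff ℝ 1 g) (hΛ : ∀ t : ℝ, 0 ≤ t → g t ∉ L.lattice)
      (halg : ∀ i : ℕ, IsAlgPt L (g (i / (m + 1 : ℕ)))),
      InSpan (Finsupp.single (⟨curve L, hE, ω, hω, wholeLift hg hΛ m halg⟩ : PeriodSymbol) (1 : ℂ) -
        ∑ i ∈ Finset.range (m + 1),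
          Finsupp.single (⟨curve L, hE, ω, hω, slotLift hg hΛ m halg i⟩ : PeriodSymbol) 1) := by
  induction m with
  | zero =>
    intro g hg hΛ halg
    have he : wholeLift hg hΛ 0 halg = slotLift hg hΛ 0 halg 0 :=
      CurvePath.eq_of_toFun_eq fun t => by simp [slot]
    rw [Finset.sum_range_one, he, sub_self]
    exact span_zero
  | succ m ih =>
    intro g hg hΛ halg
    -- the tail `g′(t) = g((1 + (m+1) t)/(m+2))`
    obtain ⟨g', hg'⟩ : ∃ g' : ℝ → ℂ, g' = fun t => g ((1 + (m + 1 : ℕ) * t) / (m + 1 + 1 : ℕ)) :=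
      ⟨_, rfl⟩
    have hg'c : ContDiff ℝ 1 g' := by
      rw [hg']
      exact hg.comp ((contDiff_const.add (contDiff_const.mul contDiff_id)).div_const _)
    have hΛ' : ∀ t : ℝ, 0 ≤ t → g' t ∉ L.lattice := fun t ht => by
      rw [hg']
      exact hΛ _ (by positivity)
    have hslot : ∀ (i : ℕ) (t : ℝ), g' (slot m i t) = g (slot (m + 1) (i + 1) t) := by
      intro i t
      rw [hg']
      simp only [slot]
      congr 1
      have h1 : ((m + 1 : ℕ) : ℝ) ≠ 0 := by exact_mod_cast Nat.succ_ne_zero m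
      field_simp
      push_cast
      ring
    have halg' : ∀ i : ℕ, IsAlgPt L (g' (i / (m + 1 : ℕ))) := fun i => by
      have h := hslot i 0
      rw [slot_zero, slot_zero] at h
      rw [h]
      exact_mod_cast halg (i + 1)
    -- splitting at `τ = 1/(m+2)`
    have hτ : (1 : ℝ) / (m + 1 + 1 : ℕ) ∈ Icc (0 : ℝ) 1 :=
      ⟨by positivity, by
        rw [div_le_one (by positivity)]
        exact_mod_cast Nat.le_add_left 1 (m + 1)⟩
    have hsplit := isElementaryRelation_split hE ω hω (wholeLift hg hΛ (m + 1) halg)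
      (slotLift hg hΛ (m + 1) halg 0) (wholeLift hg'c hΛ' m halg') hτ
      (fun t _ => by
        simp only [slotLift_toFun, wholeLift_toFun, slot]
        congr 2
        push_cast
        ring)
      (fun t _ => by
        simp only [wholeLift_toFun, hg']
        congr 2
        have h1 : ((m + 1 + 1 : ℕ) : ℝ) ≠ 0 := by exact_mod_cast Nat.succ_ne_zero (m + 1)
        field_simp
        push_cast
        ring)
    have hih := ih g' hg'c hΛ' halg'
    have hre : ∀ i ∈ Finset.range (m + 1), slotLift hg'c hΛ' m halg' i = slotLift hg hΛ (m + 1) halg (i + 1) :=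
      fun i _ => CurvePath.eq_of_toFun_eq fun t => by simp [hslot i t]
    rw [Finset.sum_range_succ' _ (m + 1)]
    have hsumeq : ∑ i ∈ Finset.range (m + 1), Finsupp.single (⟨curve L, hE, ω, hω,
        slotLift hg hΛ (m + 1) halg (i + 1)⟩ : PeriodSymbol) (1 : ℂ) =
        ∑ i ∈ Finset.range (m + 1), Finsupp.single (⟨curve L, hE, ω, hω,
          slotLift hg'c hΛ' m halg' i⟩ : PeriodSymbol) (1 : ℂ) :=
      Finset.sum_congr rfl fun i hi => by rw [hre i hi]
    rw [hsumeq]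
    obtain ⟨k, ρ, cf, hρ, hcf, hsum⟩ := span_sub hih (span_of_rel hsplit)
    refine ⟨k, ρ, cf, hρ, hcf, ?_⟩
    rw [← hsum]
    abel

/-! ### Smooth segments -/

/-- The **smooth segment** `a + s(t)(b − a)`, `s` Mathlib's smooth transition (`s = 0` on
`(−∞, 0]`, `s = 1` on `[1, ∞)`, `C^∞`, values in `[0,1]`). [folklore] -/
def smoothSeg (a b : ℂ) (t : ℝ) : ℂ := a + (Real.smoothTransition t : ℂ) * (b - a)

/-- `smoothSeg` is `C¹`. [folklore] -/
theorem contDiff_smoothSeg (a b : ℂ) : ContDiff ℝ 1 (smoothSeg a b) :=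
  contDiff_const.add ((ofRealCLM.contDiff.comp
    (Real.smoothTransition.contDiff (n := 1))).mul contDiff_const)

/-- [folklore] -/
@[simp] theorem smoothSeg_zero (a b : ℂ) : smoothSeg a b 0 = a := by
  simp [smoothSeg, Real.smoothTransition.zero]

/-- [folklore] -/
@[simp] theorem smoothSeg_one (a b : ℂ) : smoothSeg a b 1 = b := by
  simp [smoothSeg, Real.smoothTransition.one]

/-- `smoothSeg a b t = b` for `t ≥ 1`. [folklore] -/
theorem smoothSeg_of_one_le (a b : ℂ) {t : ℝ} (ht : 1 ≤ t) : smoothSeg a b t = b := by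
  simp [smoothSeg, Real.smoothTransition.one_of_one_le ht]

/-- `smoothSeg a b t = a` for `t ≤ 0`. [folklore] -/
theorem smoothSeg_of_nonpos (a b : ℂ) {t : ℝ} (ht : t ≤ 0) : smoothSeg a b t = a := by
  simp [smoothSeg, Real.smoothTransition.zero_of_nonpos ht]

/-- A point of the smooth segment is a point `a + θ(b − a)` of the segment, `θ ∈ [0,1]`.
[folklore] -/
theorem smoothSeg_mem (a b : ℂ) (t : ℝ) :
    ∃ θ ∈ Icc (0 : ℝ) 1, smoothSeg a b t = a + (θ : ℂ) * (b - a) :=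
  ⟨Real.smoothTransition t, ⟨Real.smoothTransition.nonneg t, Real.smoothTransition.le_one t⟩, rfl⟩

/-- The distance from a point of the smooth segment to `a` is at most `‖b − a‖`. [folklore] -/
theorem norm_smoothSeg_sub_le (a b : ℂ) (t : ℝ) : ‖smoothSeg a b t - a‖ ≤ ‖b - a‖ := by
  obtain ⟨θ, hθ, h⟩ := smoothSeg_mem a b t
  rw [h, add_sub_cancel_left, norm_mul, Complex.norm_real, Real.norm_eq_abs, abs_of_nonneg hθ.1]
  exact mul_le_of_le_one_left (norm_nonneg _) hθ.2

/-- **A smooth segment has the symbol of the straight segment** `φ∘[a, b]` (straight-line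
homotopy inside the segment). [cite: HuberWustholz2022, §3.3.1 (p. 42)] -/
theorem span_smoothSeg_sub_segPath (hE : (curve L).IsSmoothAffineCurve)
    (ω : Fin 2 → MvPolynomial (Fin 2) ℂ) (hω : ∀ k, HasAlgCoeffs (ω k)) {a b : ℂ}
    (hab : ∀ t ∈ Icc (0 : ℝ) 1, a + t * (b - a) ∉ L.lattice) (ha : IsAlgPt L a) (hb : IsAlgPt L b)
    (hΛ : ∀ t ∈ Icc (0 : ℝ) 1, smoothSeg a b t ∉ L.lattice) (h0 : IsAlgPt L (smoothSeg a b 0))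
    (h1 : IsAlgPt L (smoothSeg a b 1)) :
    InSpan (Finsupp.single (⟨curve L, hE, ω, hω,
        liftPath L (smoothSeg a b) (contDiff_smoothSeg a b) hΛ h0 h1⟩ : PeriodSymbol) (1 : ℂ) -
      Finsupp.single (⟨curve L, hE, ω, hω, segPath hab ha hb⟩ : PeriodSymbol) 1) := by
  have ha' : IsAlgPt L ((fun t : ℝ => a + (t : ℂ) * (b - a)) 0) := by simpa using ha
  have hb' : IsAlgPt L ((fun t : ℝ => a + (t : ℂ) * (b - a)) 1) := by simpa using hb
  have he : segPath hab ha hb = liftPath L (fun t : ℝ => a + (t : ℂ) * (b - a))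
      ((contDiff_line a (b - a)).of_le le_top) hab ha' hb' :=
    CurvePath.eq_of_toFun_eq fun t => rfl
  rw [he]
  refine span_liftPath_sub_liftPath_of_convex L hE ω hω (contDiff_smoothSeg a b)
    ((contDiff_line a (b - a)).of_le le_top) hΛ hab h0 h1 ha' hb' (by simp) (by simp) ?_
  intro s hs t ht
  have hθ := Real.smoothTransition.nonneg t
  have hθ' := Real.smoothTransition.le_one t
  have e : (1 - (s : ℂ)) * smoothSeg a b t + (s : ℂ) * (a + (t : ℂ) * (b - a)) =
      a + (((1 - s) * Real.smoothTransition t + s * t : ℝ) : ℂ) * (b - a) := by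
    simp only [smoothSeg]
    push_cast
    ring
  rw [e]
  exact hab _ ⟨by nlinarith [hs.1, hs.2, ht.1], by nlinarith [hs.1, hs.2, ht.2]⟩

/-! ### Smooth polygons -/

/-- **The smooth polygon** through the vertices `w₀, w₁, …, w_N` with `N` uniform time slots:
`Q(u) = w₀ + Σ_{j<N} s(Nu − j)(w_{j+1} − w_j)`. On the `i`-th slot `u = (i + t)/N` it equals the
smooth segment `wᵢ + s(t)(wᵢ₊₁ − wᵢ)`; it is `C¹` on `ℝ`. [folklore] -/
def polygon (w : ℕ → ℂ) (N : ℕ) (u : ℝ) : ℂ :=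
  w 0 + ∑ j ∈ Finset.range N, (Real.smoothTransition (N * u - j) : ℂ) * (w (j + 1) - w j)

/-- The smooth polygon is `C¹`. [folklore] -/
theorem contDiff_polygon (w : ℕ → ℂ) (N : ℕ) : ContDiff ℝ 1 (polygon w N) := by
  unfold polygon
  refine contDiff_const.add (ContDiff.sum fun j _ => ?_)
  exact (ofRealCLM.contDiff.comp ((Real.smoothTransition.contDiff (n := 1)).comp
    ((contDiff_const.mul contDiff_id).sub contDiff_const))).mul contDiff_const

/-- **The polygon on the `i`-th slot** (`i < N`, `t ∈ [0,1]`):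
`Q((i + t)/N) = wᵢ + s(t)(wᵢ₊₁ − wᵢ)`. [folklore] -/
theorem polygon_slot (w : ℕ → ℂ) {N i : ℕ} (hi : i < N) {t : ℝ} (ht : t ∈ Icc (0 : ℝ) 1) :
    polygon w N ((i + t) / N) = smoothSeg (w i) (w (i + 1)) t := by
  have hN : (N : ℝ) ≠ 0 := by exact_mod_cast (Nat.pos_of_ne_zero (by omega)).ne'
  have harg : ∀ j : ℕ, (N : ℝ) * ((i + t) / N) - j = (i : ℝ) - j + t := fun j => by
    field_simp
    ring
  unfold polygon smoothSeg
  simp_rw [harg]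
  rw [← Finset.sum_range_add_sum_Ico _ (Nat.succ_le_of_lt hi), Finset.sum_range_succ]
  have h1 : ∑ j ∈ Finset.range i, (Real.smoothTransition ((i : ℝ) - j + t) : ℂ) * (w (j + 1) - w j) =
      ∑ j ∈ Finset.range i, (w (j + 1) - w j) := by
    refine Finset.sum_congr rfl fun j hj => ?_
    rw [Finset.mem_range] at hj
    have hle : (1 : ℝ) ≤ (i : ℝ) - j + t := by
      have : (j : ℝ) + 1 ≤ i := by exact_mod_cast hj
      linarith [ht.1]
    rw [Real.smoothTransition.one_of_one_le hle]
    simp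
  have h2 : ∑ j ∈ Finset.Ico (i + 1) N, (Real.smoothTransition ((i : ℝ) - j + t) : ℂ) *
      (w (j + 1) - w j) = 0 := by
    refine Finset.sum_eq_zero fun j hj => ?_
    rw [Finset.mem_Ico] at hj
    have hle : (i : ℝ) - j + t ≤ 0 := by
      have : (i : ℝ) + 1 ≤ j := by exact_mod_cast hj.1
      linarith [ht.2]
    rw [Real.smoothTransition.zero_of_nonpos hle]
    simp
  rw [h1, h2, Finset.sum_range_sub, sub_self, zero_add, add_zero]
  ring

/-- The polygon passes through its vertices: `Q(i/N) = wᵢ` for `i ≤ N` (`0 < N`). [folklore] -/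
theorem polygon_vertex (w : ℕ → ℂ) {N i : ℕ} (hN : 0 < N) (hi : i ≤ N) :
    polygon w N (i / N) = w i := by
  rcases hi.lt_or_eq with h | h
  · have h' := polygon_slot w h (t := 0) ⟨le_rfl, zero_le_one⟩
    rw [add_zero] at h'
    rw [h', smoothSeg_zero]
  · subst h
    rcases Nat.exists_eq_succ_of_ne_zero hN.ne' with ⟨n, rfl⟩
    have h' := polygon_slot w (Nat.lt_succ_self n) (t := 1) ⟨zero_le_one, le_rfl⟩
    rw [smoothSeg_one] at h'
    rw [← h']
    congr 1
    push_cast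
    ring

/-- Beyond time `1` the polygon rests at its last vertex. [folklore] -/
theorem polygon_of_one_le (w : ℕ → ℂ) (N : ℕ) {u : ℝ} (hu : 1 ≤ u) : polygon w N u = w N := by
  unfold polygon
  have h1 : ∑ j ∈ Finset.range N, (Real.smoothTransition ((N : ℝ) * u - j) : ℂ) * (w (j + 1) - w j) =
      ∑ j ∈ Finset.range N, (w (j + 1) - w j) := by
    refine Finset.sum_congr rfl fun j hj => ?_
    rw [Finset.mem_range] at hj
    have hle : (1 : ℝ) ≤ (N : ℝ) * u - j := by
      have h' : (j : ℝ) + 1 ≤ N := by exact_mod_cast hj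
      have hN : (0 : ℝ) ≤ N := by positivity
      nlinarith
    rw [Real.smoothTransition.one_of_one_le hle]
    simp
  rw [h1, Finset.sum_range_sub]
  ring

/-- **Every time `u ∈ [0,1]` lies in a slot**: `u = (i + t)/N` with `i < N`, `t ∈ [0,1]`
(`0 < N`). [folklore] -/
theorem exists_slot_of_mem_Icc {N : ℕ} (hN : 0 < N) {u : ℝ} (hu : u ∈ Icc (0 : ℝ) 1) :
    ∃ i : ℕ, i < N ∧ ∃ t ∈ Icc (0 : ℝ) 1, u = (i + t) / N := by
  have hNr : (0 : ℝ) < N := by exact_mod_cast hN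
  by_cases h1 : u = 1
  · rcases Nat.exists_eq_succ_of_ne_zero hN.ne' with ⟨n, rfl⟩
    refine ⟨n, Nat.lt_succ_self n, 1, ⟨zero_le_one, le_rfl⟩, ?_⟩
    rw [h1]
    push_cast
    field_simp
  · have hu1 : u < 1 := lt_of_le_of_ne hu.2 h1
    set i := ⌊(N : ℝ) * u⌋₊ with hi
    have hfl := Nat.floor_le (mul_nonneg hNr.le hu.1)
    have hlt := Nat.lt_floor_add_one ((N : ℝ) * u)
    refine ⟨i, ?_, (N : ℝ) * u - i, ⟨by rw [hi]; linarith, by rw [hi]; linarith⟩, ?_⟩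
    · have : (i : ℝ) < N := by
        calc (i : ℝ) ≤ N * u := by rw [hi]; exact hfl
          _ < N * 1 := by nlinarith
          _ = N := mul_one _
      exact_mod_cast this
    · field_simp
      ring

/-- **The polygon stays near its current vertices**: for `u = (i + t)/N` in the `i`-th slot,
`‖Q(u) − wᵢ‖ ≤ ‖wᵢ₊₁ − wᵢ‖`. [folklore] -/
theorem norm_polygon_sub_vertex_le (w : ℕ → ℂ) {N i : ℕ} (hi : i < N) {t : ℝ} (ht : t ∈ Icc (0 : ℝ) 1) :
    ‖polygon w N ((i + t) / N) - w i‖ ≤ ‖w (i + 1) - w i‖ := by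
  rw [polygon_slot w hi ht]
  exact norm_smoothSeg_sub_le _ _ _

end Ell

end CurvePeriods

end Literature.NumberTheory.Transcendental

end
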